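import Summits.NavierStokesRegularity.NavierStokesRegularity.Theses.AffineBernoulli

/-!
# Birth skeleton (BC3) for crux `AffineBernoulli.ClosedWindowSkeleton` (stmt-NavierStokesRegularity-13661)

planner-skel-stmt-NavierStokesRegularity-13661-0 · skeleton-register (BC3, one-shot) · 2026-08-17.
Route `route-NavierStokesRegularity-AffineBernoulli` (rev 1, OPEN, deciding theorem OK), crux #3
(rank 3, OPEN, difficulty open-problem, grounded g23-9, checked g41-25; wanted only by this route).

**CLOSED-WINDOW SKELETON** (NS side of the route, card K3). For `ν, T > 0` and a maximal classical
solution `(u, p)` on `[0, T)` that is Leray–Hopf from a rapidly decaying datum and NOT Type I,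
EITHER (disjunct 1, verbatim the conclusion of `VortexLineClock.TypeIIWindowCore`, stmt-11272) an
exact window profile `(γ, U, Ω)`, `2/5 ≤ γ < 1/2`, with CIV matched decay, Lipschitz pair,
`‖Ω 0‖ = 1`, reached by a vorticity-normalised zoom at diverging local Reynolds number in `C¹_loc`,
OR (disjunct 2) a centre `c` and a profile `W ∈ 𝓔½` (the five clauses of `EulerLerayLiouville`:
`W ∈ C²`, `P ∈ C¹`, `div W = 0`, `½W + DW·(½(y−c)+W) + ∇P = 0`, `|W| ≲ ⟨y⟩⁻¹`, `|DW| ≲ ⟨y⟩⁻²`)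
with `‖W 0‖ ≥ 1/2`, reached by a sup-normalised velocity zoom `y ↦ N_k⁻¹Q_k⁻¹u(t_k, x_k + L_k Q_k y)`
(`t_k ↑ T`, `N_k ≥ ‖u(t_k)‖_∞`, `N_k → ∞`, `L_k → 0`, `N_k L_k/ν → ∞`) converging in `C¹` on balls.

## The line — EULER ZOOM · KELVIN-WINDOW RIGIDITY · WINDOW RENORMALISATION

This types the route's own TWO-LAYER PLAN for this node ("ClosedWindowSkeleton ⇐ (inviscid
velocity-core extraction at R(t_k) → ∞ with C¹_loc compactness) → (rigidity: a limit that is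
steady in log-time solves the γ = 1/2 or a window system with matched decay)") and the heuristic
recorded in the crux docstring ("a zoom at velocity scale N = g(T−t)^{-1/2} and EULER LENGTH
L = N(T−t) sees viscosity ν/g² → 0 and … the γ = 1/2 similarity system; power-law excess
g ~ (T−t)^{-δ} gives the window equation with γ = 1/2 − δ instead"). The one design decision of the
skeleton is to PIN THE ZOOM LENGTH TO THE EULER LENGTH `L_k := N_k (T − t_k)`: for an exactly
self-similar blow-up `u = (T−t)^{γ−1} U((x−x₀)/(T−t)^γ)` with ANY exponent `γ` this zoom returns the
rescaled profile `M⁻¹U(a + M·)` (`M ≈ ‖U‖_∞`), which solves the same `γ`-similarity equation with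
centre `(c − a)/M` — so one canonical zoom serves both disjuncts, and the rigidity statement S2
quantifies over canonical zooms only (with a free length `L_k ≪` core size the limit would be a
constant field and S2 would be trivially false).

* S1 `stub_eulerZoomCompactness` — EULER-ZOOM COMPACTNESS (extraction; size L, a bet). A
  non-Type-I maximal solution as in the crux has non-Type-I times `t_k ↑ T`
  (`N_k²(T−t_k)/ν → ∞`, `N_k` a sup bound of `u(t_k)` nearly attained at `x_k`:
  `‖u(t_k, x_k)‖ ≥ N_k/2`) at which the Euler length shrinks (`N_k(T−t_k) → 0`) and the
  sup-normalised, Euler-zoomed slices converge in `C¹` on balls (modulo isometries `Q_k`) to a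
  `C²` divergence-free field `W`.
* S2 `stub_kelvinWindowRigidity` — KELVIN-WINDOW RIGIDITY (identification; open problem, the
  HARDEST stub — the crux in residual form). Every such Euler-zoom limit `W` of such a solution is
  an exact steady self-similar Euler profile for SOME exponent in the CLOSED Kelvin window,
  `2/5 ≤ γ ≤ 1/2`: `(1−γ)W + DW·(γ(y−c)+W) + ∇P = 0`, `P ∈ C¹`, with CIV matched decay
  `|W| ≲ ⟨y⟩^{1−1/γ}`, `|DW| ≲ ⟨y⟩^{−1/γ}` (`γ ≥ 2/5`: finite energy, CIV Thm 2.1; `γ ≤ 1/2`: the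
  times are non-Type-I, `(T−t_k)^{γ−1/2} ↛ 0` forces `γ ≤ 1/2`, Kelvin-neutral endpoint included).
* S3 `stub_windowRenormalisation` — WINDOW RENORMALISATION (conversion; size L). If the Euler-zoom
  limit is a profile with `γ < 1/2` STRICTLY, re-zoom on the vorticity: centre at a point of the
  core with `curl ≠ 0`, amplitude `A_k = |curl u(t_k)(x'_k)|`, half-max radius `ℓ_k`; then
  `A_k ℓ_k²/ν ~ g-independent · (T−t_k)^{2γ−1}/ν → ∞` PRECISELY BECAUSE `γ < 1/2`, and the
  renormalised pair `U' = ℓ⁻¹W(y* + ℓ·)`, `Ω' = curl U'/A*` (`‖Ω' 0‖ = 1`, `m = A*`) satisfies the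
  window clauses — i.e. disjunct 1 verbatim (the conclusion of `TypeIIWindowCore`).

Composition `ClosedWindowSkeleton_of : S1 → S2 → S3 → ClosedWindowSkeleton` (proved below, no sorry,
standard axioms): extract the Euler zoom (S1), identify its limit as a `γ`-profile with
`γ ∈ [2/5, 1/2]` (S2); if `γ < 1/2` renormalise to the vorticity window core (S3, disjunct 1); if
`γ = 1/2` the limit IS the `𝓔½` profile of disjunct 2: the glue converts the matched-decay exponents
`1 − 1/γ = −1`, `−1/γ = −2` to the `⟨y⟩⁻¹ / ⟨y⟩⁻²` clauses (`Real.rpow_neg_one`, `Real.rpow_neg`,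
`Real.rpow_two`), the profile equation's `(1 − ½)` to `½`, derives the non-triviality
`‖W 0‖ ≥ 1/2` of the limit from the near-attained sup (`‖u(t_k,x_k)‖ ≥ N_k/2`, isometry invariance
of the norm, `C⁰` convergence at `y = 0`), and feeds the Euler length `L_k := N_k(T−t_k)` as the
zoom length of disjunct 2 (`L_k > 0` from `t_k < T`, `N_k L_k/ν = N_k²(T−t_k)/ν → ∞`).

## Why each stub is plausible, what it leans on, why it might fail

* S1. Plausible: in every candidate Type-II scenario on record the velocity core is smooth AT the
  blow-up scale — Hou's nearly self-similar axisymmetric interior blow-up (arXiv:2107.06509 §3.4,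
  `‖u‖∞ ~ (T−t)^{-1/2}`, Hou2022PotentiallySingularNS, Hou2026), exactly/discretely self-similar
  skeletons (Pomeau2017, arXiv:1901.09426 §3), Seregin's Euler-scaling limits (Seregin2024); the
  selection of non-Type-I times is pure logic from `¬ IsTypeIBlowup` (`∀ C`, frequently near `T`
  some `x` beats `C/√(T−t)`), slices of a classical Leray–Hopf solution from decaying data are
  bounded so `N_k` exists, and Arzelà–Ascoli on balls does the rest GIVEN uniform `C^{1,α}` bounds
  of the zoomed slices. Why it might fail: (a) those uniform bounds at the Euler length are NOT
  given by parabolic theory (the zoomed viscosity `ν/(N_k L_k) → 0`: no smoothing) — a multiscale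
  cascade with active scales between `ν/N_k` and `N_k(T−t_k)` defeats `C¹` compactness; (b) the
  Euler length must shrink, i.e. the rate at the selected times is `o((T−t)^{-1})` — true for
  every rate `(T−t)^{γ−1}`, `γ > 0`, and heuristically forced by finite energy (`γ ≥ 2/5`), but no
  unconditional upper bound on the blow-up rate of Leray–Hopf solutions is known. Leans on:
  `Literature.Analysis.FluidPDE.IsMaximalSmoothSolution`, `IsLerayHopfOn`, `HasRapidSpatialDecay`,
  `IsTypeIBlowup` (SuitableWeak.lean), Mathlib `ContDiff`, Arzelà–Ascoli
  (`BoundedContinuousFunction.arzela_ascoli`), `LinearIsometryEquiv`.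
  [Seregin2024; KochNadirashviliSereginSverak2009 (the zoom architecture); Hou2022PotentiallySingularNS]
* S2. The bet of the crux, isolated: asymptotic self-similarity of the inviscid core plus
  exponent confinement. Plausible: Kelvin's theorem pins Euler-driven collapse to `γ = 1/2`
  (Pomeau2017; GinibreLeberrePomeau2019 §4; ConstantinIgnatovaVicol2026Putative Rem. 3.6) and finite
  energy gives `γ ≥ 2/5` (CIV Thm 2.1, in tree
  `Literature.Analysis.FluidPDE.CIV2026_collapseExponent_ge_two_fifths`); the non-Type-I selection
  in S1 excludes `γ > 1/2`-type limits. Why it might fail (verbatim the crux's): Type II need not be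
  asymptotically self-similar — log-periodic (DSS) skeletons (Pomeau–Le Berre's τ-periodic
  Euler–Leray solutions, arXiv:1901.09426 §3), multiscale cascades, or a merely `C⁰`-steady limit
  escape; and the matched decay of the limit is free far-field data, not forced locally. Leans on:
  `Literature.Analysis.FluidPDE.SelfSimilar` / `SelfSimilarEulerProfile` vocabulary (profile
  equation `(1−γ)U + DU·(γ(y−c)+U) + ∇P = 0`), CIV energy bound. [Seregin2024, arXiv:1901.09426,
  ConstantinIgnatovaVicol2026Putative, arXiv:2602.17570, Chae2007]
* S3. Plausible: for an exactly self-similar `γ`-profile the computation in the bullet above is an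
  identity (`A ℓ²/ν = ‖curl U‖∞ ℓ*² (T−t)^{2γ−1}/ν`), the half-max radius exists by continuity and
  decay of `curl U`, `U' = ℓ⁻¹U(y* + ℓ·)` solves the same profile system with centre
  `(c − y*)/ℓ`, `curl U' = A* Ω'`, and matched decay transports. Why it might fail: the conversion
  needs (a) a `C²` upgrade of the velocity convergence (vorticity in `C¹`), not supplied by S1;
  (b) global Lipschitz bounds for `U'` AND `Ω' = curl U'/m` (bounded `D²W`), which the `𝓔`-type
  decay clauses do not contain; (c) the vorticity half-max ball must stay inside the region where
  the zoom converges. At `γ = 1/2` the conversion is impossible (`A ℓ²/ν` stays bounded) — which is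
  exactly why the crux keeps the `𝓔½` disjunct in velocity normalisation. Leans on:
  `Literature.Analysis.FluidPDE.curl`, `VectorCalculus.IsDivFree`, Mathlib `LipschitzWith`,
  `fderiv` calculus (chain rule under `y ↦ y* + ℓ y`). [ConstantinIgnatovaVicol2026Putative §3;
  arXiv:2511.16254; MajdaBertozzi2002]

## Disproof used / negatives / dead lines

`ledger crux ls stmt-NavierStokesRegularity-13661` (2026-08-17): no workfiles — no `Disproof.lean`,
no `Negative/` lemma, no crux idea, no earlier line; there is no `_false_without_<H>` obligation to
honour and no dead line to avoid. The item's refuter record (g41-25, g41-28, g43-4, g44-6, g44-33,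
2026-08-15): statement CHECKED, 0 refuted; noted that the crux is implied by the target `NoTypeII`
(vacuous if Type II never happens) — the same holds for S1–S3, whose hypotheses are the crux's
verbatim (no new junk: `ν > 0` divides, `N_k > 0` inverts, `1 + ‖y‖ > 0` is the rpow base,
`γ ≥ 2/5 > 0` in `1/γ`). Negatives index (`ledger negatives --problem NavierStokesRegularity`,
2026-08-17: 4 items — 4055 FiniteTangentModuli, 1832 PerpetualPump.Thesis, 1429 CorrectorSolvable,
0154 BlowupClayNonuniqueness): none concerns blow-up zooms, steady similarity profiles with
`γ ∈ [2/5, 1/2]` or vorticity renormalisation; no stub restates one.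

## BC3 audit (registrar, 2026-08-17; raw JSON in the registrar's NOTES.md, probe files in its `bc/`)

`lean check --json birth.lean`: rc 0, errors [], sorries = 3 = the three `stub_*` theorems
(warnings `declaration uses sorry` at exactly those three declarations, zero elsewhere);
`#print axioms ClosedWindowSkeleton_of` = [propext, Classical.choice, Quot.sound] (no sorryAx).
Probes (files importing ONLY this route file, hence the Statement; the stub statement copied
verbatim as `Sig.stub_X`; `maxHeartbeats 400000` per `example`): for each of S1, S2, S3 —
(P1) `Sig.stub_X → ClosedWindowSkeleton := by first | exact? | simpa | aesop` FAILS (unsolved goals,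
aesop exhaustive search failed); (P2) same after `intro h; unfold Sig.stub_X at h`, tactic set
`first | exact? | simpa using h | aesop` FAILS (S1: unsolved goals; S2, S3: heartbeat exhaustion at
whnf); (P3) same with the crux unfolded too FAILS (heartbeat exhaustion); (P4–P6) the same three
against `NavierStokesRegularity` FAIL likewise; (P7, dedup) `example : Sig.stub_X := by first |
exact? | simpa | aesop` FAILS. Split probes (one tactic each after `intro h`): `exact?` "could not
close the goal", `aesop` "made no progress", `simpa using h` type mismatch — against BOTH the crux
and the summit, for all three stubs (18/18 honest failures). Converse record (informative):
`ClosedWindowSkeleton → Sig.stub_X` by `first | exact? | aesop` FAILS for all three (no stub is a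
cheap consequence of the crux either). Verdict: 13/13 probes per stub fail; no stub is cheaply the
crux or the summit (no shredding / costume by the BC3 test).
-/

set_option linter.dupNamespace false

namespace Summit.NavierStokesRegularity.NavierStokesRegularity.Cruxes.ClosedWindowSkeleton.Birth

open Filter Topology
open Summit.NavierStokesRegularity.NavierStokesRegularity.Theses.AffineBernoulli

/-! ### The three stub statements as named propositions

`Sig.stub_X` is the statement of `stub_X` verbatim (the `example` at the end checks this
definitionally); the composing theorem takes the `Sig.stub_X` as hypotheses so that the native
skeleton audit (`#h21_check_skeleton`) sees admissible heads named like the declared stubs. -/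

/-- Statement of S1 `stub_eulerZoomCompactness` (see the stub's docstring). -/
def Sig.stub_eulerZoomCompactness : Prop :=
  ∀ (ν T : ℝ), 0 < ν → 0 < T →
    ∀ (u : ℝ → EuclideanSpace ℝ (Fin 3) → EuclideanSpace ℝ (Fin 3))
      (p : ℝ → EuclideanSpace ℝ (Fin 3) → ℝ),
    Literature.Analysis.FluidPDE.IsMaximalSmoothSolution ν 0 u p T →
    Literature.Analysis.FluidPDE.IsLerayHopfOn T ν 0 (u 0) u →
    Literature.Analysis.FluidPDE.HasRapidSpatialDecay (u 0) →
    ¬ Literature.Analysis.FluidPDE.IsTypeIBlowup u T →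
    ∃ (t : ℕ → ℝ) (x : ℕ → EuclideanSpace ℝ (Fin 3)) (N : ℕ → ℝ)
      (Q : ℕ → (EuclideanSpace ℝ (Fin 3) ≃ₗᵢ[ℝ] EuclideanSpace ℝ (Fin 3)))
      (W : EuclideanSpace ℝ (Fin 3) → EuclideanSpace ℝ (Fin 3)),
      (∀ k, 0 ≤ t k ∧ t k < T) ∧ Filter.Tendsto t Filter.atTop (nhds T) ∧
      (∀ k, 0 < N k) ∧ Filter.Tendsto N Filter.atTop Filter.atTop ∧
      Filter.Tendsto (fun k => N k * (T - t k)) Filter.atTop (nhds 0) ∧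
      Filter.Tendsto (fun k => N k * (N k * (T - t k)) / ν) Filter.atTop Filter.atTop ∧
      (∀ k z, ‖u (t k) z‖ ≤ N k) ∧ (∀ k, N k / 2 ≤ ‖u (t k) (x k)‖) ∧
      ContDiff ℝ 2 W ∧ Literature.Analysis.FluidPDE.VectorCalculus.IsDivFree W ∧
      (∀ R ε : ℝ, 0 < R → 0 < ε → ∃ k₀ : ℕ, ∀ k ≥ k₀, ∀ y : EuclideanSpace ℝ (Fin 3), ‖y‖ ≤ R →
        ‖(N k)⁻¹ • (Q k).symm (u (t k) (x k + (N k * (T - t k)) • Q k y)) - W y‖ +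
          ‖fderiv ℝ (fun y' => (N k)⁻¹ • (Q k).symm (u (t k) (x k + (N k * (T - t k)) • Q k y'))) y -
            fderiv ℝ W y‖ ≤ ε)

/-- Statement of S2 `stub_kelvinWindowRigidity` (see the stub's docstring). -/
def Sig.stub_kelvinWindowRigidity : Prop :=
  ∀ (ν T : ℝ), 0 < ν → 0 < T →
    ∀ (u : ℝ → EuclideanSpace ℝ (Fin 3) → EuclideanSpace ℝ (Fin 3))
      (p : ℝ → EuclideanSpace ℝ (Fin 3) → ℝ),
    Literature.Analysis.FluidPDE.IsMaximalSmoothSolution ν 0 u p T →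
    Literature.Analysis.FluidPDE.IsLerayHopfOn T ν 0 (u 0) u →
    Literature.Analysis.FluidPDE.HasRapidSpatialDecay (u 0) →
    ¬ Literature.Analysis.FluidPDE.IsTypeIBlowup u T →
    ∀ (t : ℕ → ℝ) (x : ℕ → EuclideanSpace ℝ (Fin 3)) (N : ℕ → ℝ)
      (Q : ℕ → (EuclideanSpace ℝ (Fin 3) ≃ₗᵢ[ℝ] EuclideanSpace ℝ (Fin 3)))
      (W : EuclideanSpace ℝ (Fin 3) → EuclideanSpace ℝ (Fin 3)),
      (∀ k, 0 ≤ t k ∧ t k < T) → Filter.Tendsto t Filter.atTop (nhds T) →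
      (∀ k, 0 < N k) → Filter.Tendsto N Filter.atTop Filter.atTop →
      Filter.Tendsto (fun k => N k * (T - t k)) Filter.atTop (nhds 0) →
      Filter.Tendsto (fun k => N k * (N k * (T - t k)) / ν) Filter.atTop Filter.atTop →
      (∀ k z, ‖u (t k) z‖ ≤ N k) → (∀ k, N k / 2 ≤ ‖u (t k) (x k)‖) →
      ContDiff ℝ 2 W → Literature.Analysis.FluidPDE.VectorCalculus.IsDivFree W →
      (∀ R ε : ℝ, 0 < R → 0 < ε → ∃ k₀ : ℕ, ∀ k ≥ k₀, ∀ y : EuclideanSpace ℝ (Fin 3), ‖y‖ ≤ R →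
        ‖(N k)⁻¹ • (Q k).symm (u (t k) (x k + (N k * (T - t k)) • Q k y)) - W y‖ +
          ‖fderiv ℝ (fun y' => (N k)⁻¹ • (Q k).symm (u (t k) (x k + (N k * (T - t k)) • Q k y'))) y -
            fderiv ℝ W y‖ ≤ ε) →
      ∃ (γ : ℝ) (c : EuclideanSpace ℝ (Fin 3)) (P : EuclideanSpace ℝ (Fin 3) → ℝ),
        (2 / 5 : ℝ) ≤ γ ∧ γ ≤ 1 / 2 ∧ ContDiff ℝ 1 P ∧
        (∀ y, (1 - γ) • W y + fderiv ℝ W y (γ • (y - c) + W y) + gradient P y = 0) ∧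
        (∃ C : ℝ, ∀ y, ‖W y‖ ≤ C * (1 + ‖y‖) ^ (1 - 1 / γ) ∧
          ‖fderiv ℝ W y‖ ≤ C * (1 + ‖y‖) ^ (-(1 / γ)))

/-- Statement of S3 `stub_windowRenormalisation` (see the stub's docstring). -/
def Sig.stub_windowRenormalisation : Prop :=
  ∀ (ν T : ℝ), 0 < ν → 0 < T →
    ∀ (u : ℝ → EuclideanSpace ℝ (Fin 3) → EuclideanSpace ℝ (Fin 3))
      (p : ℝ → EuclideanSpace ℝ (Fin 3) → ℝ),
    Literature.Analysis.FluidPDE.IsMaximalSmoothSolution ν 0 u p T →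
    Literature.Analysis.FluidPDE.IsLerayHopfOn T ν 0 (u 0) u →
    Literature.Analysis.FluidPDE.HasRapidSpatialDecay (u 0) →
    ¬ Literature.Analysis.FluidPDE.IsTypeIBlowup u T →
    ∀ (t : ℕ → ℝ) (x : ℕ → EuclideanSpace ℝ (Fin 3)) (N : ℕ → ℝ)
      (Q : ℕ → (EuclideanSpace ℝ (Fin 3) ≃ₗᵢ[ℝ] EuclideanSpace ℝ (Fin 3)))
      (W : EuclideanSpace ℝ (Fin 3) → EuclideanSpace ℝ (Fin 3)),
      (∀ k, 0 ≤ t k ∧ t k < T) → Filter.Tendsto t Filter.atTop (nhds T) →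
      (∀ k, 0 < N k) → Filter.Tendsto N Filter.atTop Filter.atTop →
      Filter.Tendsto (fun k => N k * (T - t k)) Filter.atTop (nhds 0) →
      Filter.Tendsto (fun k => N k * (N k * (T - t k)) / ν) Filter.atTop Filter.atTop →
      (∀ k z, ‖u (t k) z‖ ≤ N k) → (∀ k, N k / 2 ≤ ‖u (t k) (x k)‖) →
      ContDiff ℝ 2 W → Literature.Analysis.FluidPDE.VectorCalculus.IsDivFree W →
      (∀ R ε : ℝ, 0 < R → 0 < ε → ∃ k₀ : ℕ, ∀ k ≥ k₀, ∀ y : EuclideanSpace ℝ (Fin 3), ‖y‖ ≤ R →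
        ‖(N k)⁻¹ • (Q k).symm (u (t k) (x k + (N k * (T - t k)) • Q k y)) - W y‖ +
          ‖fderiv ℝ (fun y' => (N k)⁻¹ • (Q k).symm (u (t k) (x k + (N k * (T - t k)) • Q k y'))) y -
            fderiv ℝ W y‖ ≤ ε) →
      ∀ (γ : ℝ) (c : EuclideanSpace ℝ (Fin 3)) (P : EuclideanSpace ℝ (Fin 3) → ℝ),
        (2 / 5 : ℝ) ≤ γ → γ < 1 / 2 → ContDiff ℝ 1 P →
        (∀ y, (1 - γ) • W y + fderiv ℝ W y (γ • (y - c) + W y) + gradient P y = 0) →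
        (∃ C : ℝ, ∀ y, ‖W y‖ ≤ C * (1 + ‖y‖) ^ (1 - 1 / γ) ∧
          ‖fderiv ℝ W y‖ ≤ C * (1 + ‖y‖) ^ (-(1 / γ))) →
      (∃ (γ : ℝ) (U Ω : EuclideanSpace ℝ (Fin 3) → EuclideanSpace ℝ (Fin 3)), ((2 / 5 : ℝ) ≤ γ ∧ γ < 1 / 2 ∧ ContDiff ℝ 2 U ∧ ContDiff ℝ 1 Ω ∧ Literature.Analysis.FluidPDE.VectorCalculus.IsDivFree U ∧ (∃ m : ℝ, 0 < m ∧ ∀ y, m • Ω y = Literature.Analysis.FluidPDE.curl U y) ∧ (∃ L : NNReal, LipschitzWith L U ∧ LipschitzWith L Ω) ∧ (∃ (c : EuclideanSpace ℝ (Fin 3)) (P : EuclideanSpace ℝ (Fin 3) → ℝ), ContDiff ℝ 1 P ∧ (∀ y, (1 - γ) • U y + fderiv ℝ U y (γ • (y - c) + U y) + gradient P y = 0) ∧ (∀ y, fderiv ℝ Ω y (γ • (y - c) + U y) - fderiv ℝ U y (Ω y) = -(Ω y))) ∧ (∃ C : ℝ, ∀ y, ‖Ω y‖ ≤ C * (1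 + ‖y‖) ^ (-(1 / γ)) ∧ ‖U y‖ ≤ C * (1 + ‖y‖) ^ (1 - 1 / γ)) ∧ ‖Ω 0‖ = 1) ∧ ∃ (t : ℕ → ℝ) (x : ℕ → EuclideanSpace ℝ (Fin 3)) (A ℓ : ℕ → ℝ) (Q : ℕ → (EuclideanSpace ℝ (Fin 3) ≃ₗᵢ[ℝ] EuclideanSpace ℝ (Fin 3))), (∀ k, 0 ≤ t k ∧ t k < T) ∧ Filter.Tendsto t Filter.atTop (nhds T) ∧ (∀ k, 0 < A k ∧ 0 < ℓ k) ∧ Filter.Tendsto A Filter.atTop Filter.atTop ∧ Filter.Tendsto ℓ Filter.atTop (nhds 0) ∧ (∀ k, ‖Literature.Analysis.FluidPDE.curl (u (t k)) (x k)‖ = A k) ∧ (∀ k, (∀ z, dist z (x k) < ℓ k → A k / 2 < ‖Literature.Analysis.FluidPDE.curl (u (t k)) z‖) ∧ ∃ z, dist z (x k) = ℓ k ∧ ‖Literature.Analysis.FluidPDE.curl (u (t k)) z‖ ≤ A k / 2) ∧ Filter.Tendsto (fun k => A k * ℓ k ^ 2 / ν) Filter.atTop Filter.atTop ∧ ∀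 R ε : ℝ, 0 < R → 0 < ε → ∃ k₀ : ℕ, ∀ k ≥ k₀, ∀ y : EuclideanSpace ℝ (Fin 3), ‖y‖ ≤ R → ‖(A k)⁻¹ • (Q k).symm (Literature.Analysis.FluidPDE.curl (u (t k)) (x k + ℓ k • Q k y)) - Ω y‖ + ‖fderiv ℝ (fun y' => (A k)⁻¹ • (Q k).symm (Literature.Analysis.FluidPDE.curl (u (t k)) (x k + ℓ k • Q k y'))) y - fderiv ℝ Ω y‖ ≤ ε)

/-! ### The stubs S1–S3 (the ONLY `sorry`s of the file) -/

/-- **S1 `stub_eulerZoomCompactness` — EULER-ZOOM COMPACTNESS** (extraction; size L; a bet).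
For `ν, T > 0` and a maximal classical solution `(u, p)` on `[0, T)` which is Leray–Hopf from a
rapidly decaying datum and NOT Type I, there are times `0 ≤ t_k < T`, `t_k → T`, points `x_k`,
sup bounds `N_k > 0` of the slices (`‖u(t_k, z)‖ ≤ N_k` for all `z`) nearly attained at `x_k`
(`‖u(t_k, x_k)‖ ≥ N_k/2`), with `N_k → ∞`, NON-TYPE-I SELECTION `N_k²(T−t_k)/ν → ∞` (= local
Reynolds number `N_k L_k/ν` at the Euler length) and SHRINKING EULER LENGTH `L_k := N_k(T−t_k) → 0`,
isometries `Q_k`, and a `C²` divergence-free `W : ℝ³ → ℝ³` such that the sup-normalised Euler zoom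
`y ↦ N_k⁻¹Q_k⁻¹u(t_k, x_k + N_k(T−t_k)·Q_k y)` converges to `W` in `C¹` on every ball.
WHY PLAUSIBLE / WHY IT MIGHT FAIL / LEANS ON: module docstring, S1. The selection of non-Type-I
times and the existence of `N_k, x_k` are routine (negation of `IsTypeIBlowup`; bounded smooth
slices); the content is the uniform `C^{1,α}` bound of the zoomed slices at the Euler length (no
parabolic smoothing survives there) and the shrinking of the Euler length (rate `o((T−t)^{-1})`).
[Seregin2024; KochNadirashviliSereginSverak2009; Hou2022PotentiallySingularNS; arXiv:1901.09426] -/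
theorem stub_eulerZoomCompactness :
  ∀ (ν T : ℝ), 0 < ν → 0 < T →
    ∀ (u : ℝ → EuclideanSpace ℝ (Fin 3) → EuclideanSpace ℝ (Fin 3))
      (p : ℝ → EuclideanSpace ℝ (Fin 3) → ℝ),
    Literature.Analysis.FluidPDE.IsMaximalSmoothSolution ν 0 u p T →
    Literature.Analysis.FluidPDE.IsLerayHopfOn T ν 0 (u 0) u →
    Literature.Analysis.FluidPDE.HasRapidSpatialDecay (u 0) →
    ¬ Literature.Analysis.FluidPDE.IsTypeIBlowup u T →
    ∃ (t : ℕ → ℝ) (x : ℕ → EuclideanSpace ℝ (Fin 3)) (N : ℕ → ℝ)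
      (Q : ℕ → (EuclideanSpace ℝ (Fin 3) ≃ₗᵢ[ℝ] EuclideanSpace ℝ (Fin 3)))
      (W : EuclideanSpace ℝ (Fin 3) → EuclideanSpace ℝ (Fin 3)),
      (∀ k, 0 ≤ t k ∧ t k < T) ∧ Filter.Tendsto t Filter.atTop (nhds T) ∧
      (∀ k, 0 < N k) ∧ Filter.Tendsto N Filter.atTop Filter.atTop ∧
      Filter.Tendsto (fun k => N k * (T - t k)) Filter.atTop (nhds 0) ∧
      Filter.Tendsto (fun k => N k * (N k * (T - t k)) / ν) Filter.atTop Filter.atTop ∧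
      (∀ k z, ‖u (t k) z‖ ≤ N k) ∧ (∀ k, N k / 2 ≤ ‖u (t k) (x k)‖) ∧
      ContDiff ℝ 2 W ∧ Literature.Analysis.FluidPDE.VectorCalculus.IsDivFree W ∧
      (∀ R ε : ℝ, 0 < R → 0 < ε → ∃ k₀ : ℕ, ∀ k ≥ k₀, ∀ y : EuclideanSpace ℝ (Fin 3), ‖y‖ ≤ R →
        ‖(N k)⁻¹ • (Q k).symm (u (t k) (x k + (N k * (T - t k)) • Q k y)) - W y‖ +
          ‖fderiv ℝ (fun y' => (N k)⁻¹ • (Q k).symm (u (t k) (x k + (N k * (T - t k)) • Q k y'))) y -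
            fderiv ℝ W y‖ ≤ ε) := by
  sorry

/-- **S2 `stub_kelvinWindowRigidity` — KELVIN-WINDOW RIGIDITY** (identification; open problem —
the HARDEST stub, the crux in residual form). For a solution as in the crux and ANY Euler zoom of
it as produced by S1 (same clauses, now hypotheses), the limit `W` is an exact steady self-similar
Euler profile with SOME exponent in the closed Kelvin window: there are `γ ∈ [2/5, 1/2]`, a centre
`c` and a `C¹` pressure `P` with `(1−γ)W + DW·(γ(y−c)+W) + ∇P = 0` on `ℝ³`, and CIV matched decay
`‖W y‖ ≤ C⟨y⟩^{1−1/γ}`, `‖DW y‖ ≤ C⟨y⟩^{−1/γ}` (`⟨y⟩ = 1 + ‖y‖`, real powers). At `γ = 1/2` these are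
exactly the `𝓔½` clauses of `EulerLerayLiouville` (`⟨y⟩⁻¹`, `⟨y⟩⁻²`); for `γ < 1/2` they are the
velocity-side window clauses. WHY PLAUSIBLE / WHY IT MIGHT FAIL / LEANS ON: module docstring, S2 —
asymptotic self-similarity of the inviscid core is the bet of the whole crux; `γ ≥ 2/5` is the
finite-energy bound (CIV Thm 2.1), `γ ≤ 1/2` is forced by the non-Type-I selection of the times;
DSS / log-periodic skeletons (arXiv:1901.09426 §3) and cascades escape. [Seregin2024,
arXiv:1901.09426, ConstantinIgnatovaVicol2026Putative, arXiv:2602.17570, Pomeau2017, Chae2007] -/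
theorem stub_kelvinWindowRigidity :
  ∀ (ν T : ℝ), 0 < ν → 0 < T →
    ∀ (u : ℝ → EuclideanSpace ℝ (Fin 3) → EuclideanSpace ℝ (Fin 3))
      (p : ℝ → EuclideanSpace ℝ (Fin 3) → ℝ),
    Literature.Analysis.FluidPDE.IsMaximalSmoothSolution ν 0 u p T →
    Literature.Analysis.FluidPDE.IsLerayHopfOn T ν 0 (u 0) u →
    Literature.Analysis.FluidPDE.HasRapidSpatialDecay (u 0) →
    ¬ Literature.Analysis.FluidPDE.IsTypeIBlowup u T →
    ∀ (t : ℕ → ℝ) (x : ℕ → EuclideanSpace ℝ (Fin 3)) (N : ℕ → ℝ)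
      (Q : ℕ → (EuclideanSpace ℝ (Fin 3) ≃ₗᵢ[ℝ] EuclideanSpace ℝ (Fin 3)))
      (W : EuclideanSpace ℝ (Fin 3) → EuclideanSpace ℝ (Fin 3)),
      (∀ k, 0 ≤ t k ∧ t k < T) → Filter.Tendsto t Filter.atTop (nhds T) →
      (∀ k, 0 < N k) → Filter.Tendsto N Filter.atTop Filter.atTop →
      Filter.Tendsto (fun k => N k * (T - t k)) Filter.atTop (nhds 0) →
      Filter.Tendsto (fun k => N k * (N k * (T - t k)) / ν) Filter.atTop Filter.atTop →
      (∀ k z, ‖u (t k) z‖ ≤ N k) → (∀ k, N k / 2 ≤ ‖u (t k) (x k)‖) →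
      ContDiff ℝ 2 W → Literature.Analysis.FluidPDE.VectorCalculus.IsDivFree W →
      (∀ R ε : ℝ, 0 < R → 0 < ε → ∃ k₀ : ℕ, ∀ k ≥ k₀, ∀ y : EuclideanSpace ℝ (Fin 3), ‖y‖ ≤ R →
        ‖(N k)⁻¹ • (Q k).symm (u (t k) (x k + (N k * (T - t k)) • Q k y)) - W y‖ +
          ‖fderiv ℝ (fun y' => (N k)⁻¹ • (Q k).symm (u (t k) (x k + (N k * (T - t k)) • Q k y'))) y -
            fderiv ℝ W y‖ ≤ ε) →
      ∃ (γ : ℝ) (c : EuclideanSpace ℝ (Fin 3)) (P : EuclideanSpace ℝ (Fin 3) → ℝ),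
        (2 / 5 : ℝ) ≤ γ ∧ γ ≤ 1 / 2 ∧ ContDiff ℝ 1 P ∧
        (∀ y, (1 - γ) • W y + fderiv ℝ W y (γ • (y - c) + W y) + gradient P y = 0) ∧
        (∃ C : ℝ, ∀ y, ‖W y‖ ≤ C * (1 + ‖y‖) ^ (1 - 1 / γ) ∧
          ‖fderiv ℝ W y‖ ≤ C * (1 + ‖y‖) ^ (-(1 / γ))) := by
  sorry

/-- **S3 `stub_windowRenormalisation` — WINDOW RENORMALISATION** (conversion; size L). For a
solution as in the crux, an Euler zoom of it as produced by S1 (clauses as hypotheses) and an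
identification of its limit `W` as a `γ`-profile (clauses of S2's conclusion) with `γ < 1/2`
STRICTLY, the conclusion of `VortexLineClock.TypeIIWindowCore` holds verbatim (disjunct 1 of the
crux): a window profile `(γ', U, Ω)`, `2/5 ≤ γ' < 1/2`, `U ∈ C²` divergence-free, `Ω ∈ C¹`,
`m Ω = curl U` (`m > 0`), common Lipschitz constant, velocity and vorticity profile equations about
some centre, matched decay, `‖Ω 0‖ = 1`, reached by a vorticity-normalised zoom (amplitude
`A_k = |curl u(t_k)(x_k)|`, half-max radius `ℓ_k`, `A_k → ∞`, `ℓ_k → 0`, `A_k ℓ_k²/ν → ∞`) in `C¹`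
on balls. Intended: `γ' = γ`, re-centre at a core point with `curl W ≠ 0`, `U = ℓ⁻¹W(y* + ℓ·)`,
`Ω = curl U / A*`; `A_k ℓ_k²/ν ≍ (T−t_k)^{2γ−1}/ν → ∞` because `γ < 1/2`. WHY IT MIGHT FAIL / LEANS
ON: module docstring, S3 — needs a `C²` upgrade of the convergence, bounded `D²W` for the Lipschitz
pair, and the half-max ball inside the convergence region. [ConstantinIgnatovaVicol2026Putative §3,
arXiv:2602.17570, arXiv:2511.16254, MajdaBertozzi2002] -/
theorem stub_windowRenormalisation :
  ∀ (ν T : ℝ), 0 < ν → 0 < T →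
    ∀ (u : ℝ → EuclideanSpace ℝ (Fin 3) → EuclideanSpace ℝ (Fin 3))
      (p : ℝ → EuclideanSpace ℝ (Fin 3) → ℝ),
    Literature.Analysis.FluidPDE.IsMaximalSmoothSolution ν 0 u p T →
    Literature.Analysis.FluidPDE.IsLerayHopfOn T ν 0 (u 0) u →
    Literature.Analysis.FluidPDE.HasRapidSpatialDecay (u 0) →
    ¬ Literature.Analysis.FluidPDE.IsTypeIBlowup u T →
    ∀ (t : ℕ → ℝ) (x : ℕ → EuclideanSpace ℝ (Fin 3)) (N : ℕ → ℝ)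
      (Q : ℕ → (EuclideanSpace ℝ (Fin 3) ≃ₗᵢ[ℝ] EuclideanSpace ℝ (Fin 3)))
      (W : EuclideanSpace ℝ (Fin 3) → EuclideanSpace ℝ (Fin 3)),
      (∀ k, 0 ≤ t k ∧ t k < T) → Filter.Tendsto t Filter.atTop (nhds T) →
      (∀ k, 0 < N k) → Filter.Tendsto N Filter.atTop Filter.atTop →
      Filter.Tendsto (fun k => N k * (T - t k)) Filter.atTop (nhds 0) →
      Filter.Tendsto (fun k => N k * (N k * (T - t k)) / ν) Filter.atTop Filter.atTop →
      (∀ k z, ‖u (t k) z‖ ≤ N k) → (∀ k, N k / 2 ≤ ‖u (t k) (x k)‖) →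
      ContDiff ℝ 2 W → Literature.Analysis.FluidPDE.VectorCalculus.IsDivFree W →
      (∀ R ε : ℝ, 0 < R → 0 < ε → ∃ k₀ : ℕ, ∀ k ≥ k₀, ∀ y : EuclideanSpace ℝ (Fin 3), ‖y‖ ≤ R →
        ‖(N k)⁻¹ • (Q k).symm (u (t k) (x k + (N k * (T - t k)) • Q k y)) - W y‖ +
          ‖fderiv ℝ (fun y' => (N k)⁻¹ • (Q k).symm (u (t k) (x k + (N k * (T - t k)) • Q k y'))) y -
            fderiv ℝ W y‖ ≤ ε) →
      ∀ (γ : ℝ) (c : EuclideanSpace ℝ (Fin 3)) (P : EuclideanSpace ℝ (Fin 3) → ℝ),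
        (2 / 5 : ℝ) ≤ γ → γ < 1 / 2 → ContDiff ℝ 1 P →
        (∀ y, (1 - γ) • W y + fderiv ℝ W y (γ • (y - c) + W y) + gradient P y = 0) →
        (∃ C : ℝ, ∀ y, ‖W y‖ ≤ C * (1 + ‖y‖) ^ (1 - 1 / γ) ∧
          ‖fderiv ℝ W y‖ ≤ C * (1 + ‖y‖) ^ (-(1 / γ))) →
      (∃ (γ : ℝ) (U Ω : EuclideanSpace ℝ (Fin 3) → EuclideanSpace ℝ (Fin 3)), ((2 / 5 : ℝ) ≤ γ ∧ γ < 1 / 2 ∧ ContDiff ℝ 2 U ∧ ContDiff ℝ 1 Ω ∧ Literature.Analysis.FluidPDE.VectorCalculus.IsDivFree U ∧ (∃ m : ℝ, 0 < m ∧ ∀ y, m • Ω y = Literature.Analysis.FluidPDE.curl U y) ∧ (∃ L : NNReal, LipschitzWith L U ∧ LipschitzWith L Ω) ∧ (∃ (c : EuclideanSpace ℝ (Fin 3)) (P : EuclideanSpace ℝ (Fin 3) → ℝ), ContDiff ℝ 1 P ∧ (∀ y, (1 - γ) • U y + fderiv ℝ U y (γ • (y - c) + U y) + gradient P y = 0)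 ∧ (∀ y, fderiv ℝ Ω y (γ • (y - c) + U y) - fderiv ℝ U y (Ω y) = -(Ω y))) ∧ (∃ C : ℝ, ∀ y, ‖Ω y‖ ≤ C * (1 + ‖y‖) ^ (-(1 / γ)) ∧ ‖U y‖ ≤ C * (1 + ‖y‖) ^ (1 - 1 / γ)) ∧ ‖Ω 0‖ = 1) ∧ ∃ (t : ℕ → ℝ) (x : ℕ → EuclideanSpace ℝ (Fin 3)) (A ℓ : ℕ → ℝ) (Q : ℕ → (EuclideanSpace ℝ (Fin 3) ≃ₗᵢ[ℝ] EuclideanSpace ℝ (Fin 3))), (∀ k, 0 ≤ t k ∧ t k < T) ∧ Filter.Tendsto t Filter.atTop (nhds T) ∧ (∀ k, 0 < A k ∧ 0 < ℓ k) ∧ Filter.Tendsto A Filter.atTop Filter.atTop ∧ Filter.Tendsto ℓ Filter.atTop (nhds 0) ∧ (∀ k, ‖Literature.Analysis.FluidPDE.curl (u (t k)) (x k)‖ = A k) ∧ (∀ k, (∀ z, dist z (x k) < ℓ k → A k / 2 < ‖Literature.Analysis.FluidPDE.curl (u (t k)) z‖) ∧ ∃ z, dist z (x k) = ℓ k ∧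 ‖Literature.Analysis.FluidPDE.curl (u (t k)) z‖ ≤ A k / 2) ∧ Filter.Tendsto (fun k => A k * ℓ k ^ 2 / ν) Filter.atTop Filter.atTop ∧ ∀ R ε : ℝ, 0 < R → 0 < ε → ∃ k₀ : ℕ, ∀ k ≥ k₀, ∀ y : EuclideanSpace ℝ (Fin 3), ‖y‖ ≤ R → ‖(A k)⁻¹ • (Q k).symm (Literature.Analysis.FluidPDE.curl (u (t k)) (x k + ℓ k • Q k y)) - Ω y‖ + ‖fderiv ℝ (fun y' => (A k)⁻¹ • (Q k).symm (Literature.Analysis.FluidPDE.curl (u (t k)) (x k + ℓ k • Q k y'))) y - fderiv ℝ Ω y‖ ≤ ε) := by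
  sorry

/-! ### The composition (kernel-checked, sorry-free): S1 → S2 → S3 → the crux, BY NAME -/

/-- **`ClosedWindowSkeleton` from the three stub statements.** Given a non-Type-I maximal solution
as in the crux: extract the Euler zoom and its `C¹_loc` limit `W` (S1); identify `W` as a steady
self-similar Euler profile with exponent `γ ∈ [2/5, 1/2]`, centre `c`, pressure `P` and matched
decay (S2). If `γ < 1/2`, renormalise to the vorticity window core (S3): disjunct 1. If `γ = 1/2`,
`W` is the `𝓔½` profile of disjunct 2: the matched-decay exponents `1 − 1/γ = −1`, `−1/γ = −2`
become the `⟨y⟩⁻¹` / `⟨y⟩⁻²` clauses, the profile equation's `(1 − ½)` becomes `½`, the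
non-triviality `‖W 0‖ ≥ 1/2` follows from the nearly attained sup (`‖u(t_k, x_k)‖ ≥ N_k/2`,
isometry invariance of the norm, `C⁰` convergence at `y = 0`), and the Euler length
`L_k := N_k(T−t_k)` is the zoom length (`L_k > 0` from `t_k < T`; `N_k L_k/ν = N_k²(T−t_k)/ν`). -/
theorem ClosedWindowSkeleton_of :
    Sig.stub_eulerZoomCompactness → Sig.stub_kelvinWindowRigidity → Sig.stub_windowRenormalisation →
      Summit.NavierStokesRegularity.NavierStokesRegularity.Theses.AffineBernoulli.ClosedWindowSkeleton := by
  intro hS1 hS2 hS3 ν T hν hT u p hmax hLH hdat hnI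
  -- S1: the Euler zoom and its limit
  obtain ⟨t, x, N, Q, W, ht, htT, hNpos, hNtop, hL0, hRe, hbd, hnear, hW2, hdiv, hconv⟩ :=
    hS1 ν T hν hT u p hmax hLH hdat hnI
  -- S2: the limit is a `γ`-profile with `γ` in the closed Kelvin window
  obtain ⟨γ, c, P, hγlo, hγhi, hP1, heq, hdec⟩ :=
    hS2 ν T hν hT u p hmax hLH hdat hnI t x N Q W ht htT hNpos hNtop hL0 hRe hbd hnear hW2 hdiv hconv
  rcases hγhi.lt_or_eq with hlt | hhalf
  · -- `γ < 1/2`: S3 renormalises to the vorticity window core (disjunct 1 verbatim)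
    exact Or.inl (hS3 ν T hν hT u p hmax hLH hdat hnI t x N Q W ht htT hNpos hNtop hL0 hRe hbd hnear
      hW2 hdiv hconv γ c P hγlo hlt hP1 heq hdec)
  · -- `γ = 1/2`: the limit is the `𝓔½` profile of disjunct 2
    subst hhalf
    -- non-triviality of the limit from the nearly attained sup
    have hW0 : (1 / 2 : ℝ) ≤ ‖W 0‖ := by
      by_contra hlt
      push Not at hlt
      obtain ⟨k₀, hk₀⟩ := hconv 1 ((1 / 2 - ‖W 0‖) / 2) one_pos (by linarith)
      have hk := hk₀ k₀ le_rfl 0 (by simp)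
      simp only [map_zero, smul_zero, add_zero] at hk
      have h1 : ‖(N k₀)⁻¹ • (Q k₀).symm (u (t k₀) (x k₀)) - W 0‖ ≤ (1 / 2 - ‖W 0‖) / 2 :=
        le_trans (le_add_of_nonneg_right (norm_nonneg _)) hk
      have h2 := norm_sub_norm_le ((N k₀)⁻¹ • (Q k₀).symm (u (t k₀) (x k₀))) (W 0)
      have h3 : (1 / 2 : ℝ) ≤ ‖(N k₀)⁻¹ • (Q k₀).symm (u (t k₀) (x k₀))‖ := by
        rw [norm_smul, LinearIsometryEquiv.norm_map,
          Real.norm_of_nonneg (inv_nonneg.mpr (hNpos k₀).le), le_inv_mul_iff₀ (hNpos k₀)]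
        have := hnear k₀
        linarith
      linarith
    obtain ⟨C, hC⟩ := hdec
    refine Or.inr ⟨c, W, P, hW2, hP1, hdiv, ?_, ⟨C, fun y => ?_⟩, hW0, t, x, N, fun k => N k * (T - t k),
      Q, ht, htT, ?_, hNtop, hL0, hbd, hRe, hconv⟩
    · -- the profile equation at `γ = 1/2`
      intro y
      have h := heq y
      rwa [show ((1 : ℝ) - 1 / 2) = 1 / 2 by norm_num] at h
    · -- matched decay at `γ = 1/2` is the `𝓔½` decay
      obtain ⟨h1, h2⟩ := hC y
      have hpos : (0 : ℝ) ≤ 1 + ‖y‖ := by positivity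
      refine ⟨?_, ?_⟩
      · rwa [show ((1 : ℝ) - 1 / (1 / 2)) = -1 by norm_num, Real.rpow_neg_one] at h1
      · rwa [show (-(1 / (1 / 2)) : ℝ) = -(2 : ℝ) by norm_num, Real.rpow_neg hpos,
          Real.rpow_two] at h2
    · -- positivity of the sup bounds and of the Euler lengths
      exact fun k => ⟨hNpos k, mul_pos (hNpos k) (sub_pos.mpr (ht k).2)⟩

/-- WIRING CHECK: the three sorried stubs compose to a closed term of the crux's type (modulo their
`sorry`s), so each stub's explicit signature is literally its `Sig` statement. Deliberately an
`example` — no constant of type `ClosedWindowSkeleton` enters the environment, so a probe importing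
this file cannot close `stub → ClosedWindowSkeleton` by `exact?` through a pre-composed witness. -/
example : Summit.NavierStokesRegularity.NavierStokesRegularity.Theses.AffineBernoulli.ClosedWindowSkeleton :=
  ClosedWindowSkeleton_of stub_eulerZoomCompactness stub_kelvinWindowRigidity stub_windowRenormalisation

end Summit.NavierStokesRegularity.NavierStokesRegularity.Cruxes.ClosedWindowSkeleton.Birth
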